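import Summits.BirchSwinnertonDyer.Rank1Residual.Additive.PotSupersingularWildNotCotorsion
import Summits.BirchSwinnertonDyer.BirchSwinnertonDyer.Theorems.PublishedInputsGreenbergRelaxedCountHolds
import Literature.NumberTheory.EllipticCurves.Greenberg1999.LocalH1DivisibleCyclotomicProofs
import HarnessLib

set_option linter.dupNamespace false -- `…BirchSwinnertonDyer.BirchSwinnertonDyer…` is the cell's nested layout (D-0017)
set_option autoImplicit false

/-!
# Greenberg LNM 1716 Thm. 1.7 (P. Schneider) at the ODD ADDITIVE potentially supersingular primes of `E/ℚ` (classes O5/O6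
# of cell `b2b-bsdres`) — UNCONDITIONAL: `X_E(ℚ_∞)` is not `Λ`-torsion

Seat `bsd-inputs-k4-p1` (gen 3; LADDER-BSD D-0154 KEY (147)(f) «prove the printed input», row 1 K4 INPUTS),
`--supports stmt-BirchSwinnertonDyer-20309`. THEOREMS ONLY (no definition, no named fact, no `sorry`); nothing is restated.

Greenberg LNM 1716 Thm. 1.7 (p. 61): "`corank_Λ Sel_E(F_∞)_p ≥ r(E, F)`", `r(E, F) = ∑ [F_v : ℚ_p]` over the primes `v ∣ p` of
POTENTIALLY supersingular reduction ("If `E` has potentially supersingular reduction at `v` …", §2 p. 84). The good supersingular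
case is `InputsGreenbergRelaxedCount.not_isTorsion_of_supersingular_holds` (this seat, p633316, every number field). The cell
`b2b-bsdres` (`Summits/BirchSwinnertonDyer/Rank1Residual/Additive/PotSupersingular*NotCotorsion`) proved the ADDITIVE
potentially-supersingular case over `ℚ` at an odd prime `p` — classes **O5** (tame potentially supersingular: `(G) ∧ ss` or `(t′)`)
and **O6** (wild, `p = 3`) of its residual map — MODULO three named inputs taken as hypotheses: `hCG : H1_goodModelKernel_trivial.{0}`
(Coates–Greenberg Cor. 3.2 for good models), `hCD : Greenberg1999.localH1_primaryTorsion_divisible_cyclotomic.{0}` (LNM 1716 §4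
Lemma 4.5 ff.: `H¹((K_∞)_η, E[p^∞])` divisible, `cd_p = 1`) and `hI1 : WeierstrassCurve.relaxedSelmer_torsion_card_growth.{0}`
(the finite-level count of p. 62). ALL THREE are now tree theorems — `H1_goodModelKernel_trivial_holds` (Tate's almost étale lemma,
`…CoatesGreenbergUnconditional`), `Greenberg1999.localH1_primaryTorsion_divisible_cyclotomic_holds`
(`Greenberg1999/LocalH1DivisibleCyclotomicProofs`), `InputsGreenbergRelaxedCount.relaxedSelmer_torsion_card_growth_holds`
(p633316, from Poitou–Tate over the layers) — so the cell's theorems hold UNCONDITIONALLY: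

* `not_isTorsion_of_classO5_or_classO6_holds` — for `W/ℚ` globally minimal, `p` prime with `ClassO5 W p ∨ ClassO6 W p`, the
  cyclotomic `ℤ_p`-extension `κ` with topological generator `γ`, and every Pontryagin-dual datum `D` of `Sel_E(ℚ_∞)_p`: `¬ D.IsTorsion`;
* `ClassO5.not_isTorsion_holds`, `ClassO6.not_isTorsion_holds` — the two classes separately.

## Honest framing

COMPOSITIONS only (the mathematics is the cell's and the cited input files'); a NEGATIVE structural theorem (positive `Λ`-corank on
these rows: it closes no residual pair — O5/O6 stay open in the cell's census); no item is closed; no crux and no summit statement is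
proved by this seat; the Birch–Swinnerton-Dyer conjecture is NOT proved by any of this.

References: [GreenbergLNM1716] Thm. 1.7 (pp. 61–62), §2 p. 84, §4 Lemma 4.5; [CoatesGreenberg1996] Cor. 3.2, Thm. 2.13; [Tate1967] §3.2;
[MilneADT2006] I Thm. 4.10 (b).
-/

noncomputable section

open scoped Classical

open Literature.NumberTheory.EllipticCurves Literature.NumberTheory.EllipticCurves.CoatesGreenberg1996
  Literature.NumberTheory.GaloisRepresentations WeierstrassCurve
  Summit.BirchSwinnertonDyer.Rank1Residual.Additive Summit.BirchSwinnertonDyer.Rank1Residual.Additive.GoodModelLine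

namespace Summit.BirchSwinnertonDyer.BirchSwinnertonDyer.Theorems.InputsGreenbergRelaxedCount

section Additive

/-! The parameters: a globally minimal `W/ℚ`, a prime `p`, the `ℤ_p`-extension `κ` with an element `γ`, a dual datum `D`. -/
variable (W : WeierstrassCurve ℚ) [W.IsElliptic] [W.IsGloballyMinimal] (p : ℕ) [hp : Fact p.Prime]
  {κ : ZpExtension ℚ p} {γ : Field.absoluteGaloisGroup ℚ} (D : SelmerDualData W κ γ)

/-- **Greenberg Thm. 1.7 at an odd additive potentially supersingular prime of `E/ℚ` (classes O5 ∪ O6) — UNCONDITIONAL:**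
for `W/ℚ` globally minimal, `p` with `ClassO5 W p ∨ ClassO6 W p` (odd additive prime of tame resp. wild potentially supersingular
type), `κ` CYCLOTOMIC with topological generator `γ`, and every Pontryagin-dual datum `D` of `Sel_E(ℚ_∞)_p`, the dual `X_E(ℚ_∞) = D.X`
is NOT `Λ`-torsion. The cell's `GoodModelLine.not_isTorsion_of_classO5_or_classO6` with `hCG`, `hCD`, `hI1` discharged by the
tree theorems named in the module docstring. [cite: GreenbergLNM1716, Thm. 1.7 (pp. 61–62) and §2 (p. 84)]
[cite: CoatesGreenberg1996, Cor. 3.2 with Thm. 2.13] [cite: MilneADT2006, Ch. I, Thm. 4.10 (b)] -/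
theorem not_isTorsion_of_classO5_or_classO6_holds (hO : ClassO5 W p ∨ ClassO6 W p) (hκ : κ.IsCyclotomic)
    (hγ : κ.IsTopGenerator γ) : ¬ D.IsTorsion :=
  not_isTorsion_of_classO5_or_classO6 W p H1_goodModelKernel_trivial_holds
    Greenberg1999.localH1_primaryTorsion_divisible_cyclotomic_holds relaxedSelmer_torsion_card_growth_holds hO D hκ hγ

/-- **Class O5 (odd additive, TAME potentially supersingular) — UNCONDITIONAL `¬ D.IsTorsion`** (cyclotomic `κ`, topological
generator `γ`): the cell's `ClassO5.not_isTorsion` with `hCG`, `hI1` discharged. [cite: GreenbergLNM1716, Thm. 1.7 (pp. 61–62) and §2 (p. 84)] -/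
theorem ClassO5.not_isTorsion_holds (hO : ClassO5 W p) (hκ : κ.IsCyclotomic) (hγ : κ.IsTopGenerator γ) : ¬ D.IsTorsion :=
  ClassO5.not_isTorsion W p H1_goodModelKernel_trivial_holds relaxedSelmer_torsion_card_growth_holds hO D hκ hγ

/-- **Class O6 (wild additive at `p = 3`, potentially supersingular) — UNCONDITIONAL `¬ D.IsTorsion`** (cyclotomic `κ`,
topological generator `γ`): the cell's `ClassO6.not_isTorsion` with `hCG`, `hCD`, `hI1` discharged.
[cite: GreenbergLNM1716, Thm. 1.7 (pp. 61–62), §2 (p. 84), §4 Lemma 4.5] -/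
theorem ClassO6.not_isTorsion_holds (hO : ClassO6 W p) (hκ : κ.IsCyclotomic) (hγ : κ.IsTopGenerator γ) : ¬ D.IsTorsion :=
  ClassO6.not_isTorsion W p H1_goodModelKernel_trivial_holds Greenberg1999.localH1_primaryTorsion_divisible_cyclotomic_holds
    relaxedSelmer_torsion_card_growth_holds hO D hκ hγ

end Additive

end Summit.BirchSwinnertonDyer.BirchSwinnertonDyer.Theorems.InputsGreenbergRelaxedCount

end
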